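import Literature.NumberTheory.Automorphic.ArchCoefficientModule
import Literature.NumberTheory.Automorphic.ResGLnCohomology
import HarnessLib

/-!
# The archimedean coefficient module `E_λ(ℂ) = ⨂_τ V_{λ_τ}(ℂ) ∘ GL_n(τ̃)` of `Res_{K/ℚ} GL_n`
# for a GENERAL weight family `λ = (λ_τ)_{τ : K →+* ℂ}`, as a `(𝔤, K_∞)`-module

Topic `NumberTheory/Automorphic`; namespace `Literature.NumberTheory.Automorphic.ResGLnCohomology`
(the grouping namespace of the receptacle
`ResGLnCohomology.levelCohomology k n K 𝔫 λ q = H^q(GL_n(K)⁺, Fun(GL_n(𝔸_K^∞)/K_f(𝔫), E_λ(k)))`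
of `ResGLnCohomology.lean` and of the named fact `ResGLnCohomology.cuspidalEigenclass_exists`).
Definitions with bodies and theorems; no named fact, no instance, no `sorry`.

The tree's `ParallelWeight.archCoeffRep F n wt` (`ArchCoefficientModule.lean`) is the archimedean
coefficient `(𝔤, K_∞)`-module for a PARALLEL weight (the same `wt` at every embedding), the source
of the Eichler–Shimura / Borel–Wallach comparison for `ParallelWeight.cohomology`.  The
cuspidal-eigenclass statement for `Res_{K/ℚ} GL_n` over a general number field
(`ResGLnCohomology.cuspidalEigenclass_exists`: Clozel's Lemme 3.15, Borel's regularization,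
Franke's Thm. 18) and its Bianchi slice (`bianchi_cuspidal_regularLAlgebraic_eigenclassExists`,
whose weights `λ_σ`, `λ_σ̄` at the two embeddings of an imaginary quadratic field differ by a
determinant twist in general) live on the coefficient module
`ResGLnCohomology.CoeffModule k n K λ = ⨂_{τ : K →+* k} V_{λ_τ}(k)` with ONE highest weight per
embedding [cite: GrobnerRaghuram2014, §7.1 (E_μ = ⊗_v E_{μ_v})] [cite: Clozel1990, §3.5 (p. 122)];
the comparison map `H^q(𝔤, K_∞; π ⊗ E_λ(ℂ)) → H^q(S_{K_f}, Ẽ_λ)` therefore needs `E_λ(ℂ)` as a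
`(𝔤, K_∞)`-module of `G_∞ = GL_n(K_∞)` restricting on `GL_n(K)` to the Betti coefficients
`ResGLnCohomology.coeffRep ℂ n K λ`.  THIS FILE builds it, factor by factor from the tree's
one-embedding pieces `ParallelWeight.factorRep K n (λ τ) τ = V_{λ_τ}(ℂ) ∘ GL_n(τ̃)` (`τ̃ : K_∞ → ℂ`
the continuous real-algebra morphism extending `τ`, `embeddingExt`):

* `ResGLnCohomology.archCoeffRep n K λ : Representation ℂ G_∞ (CoeffModule ℂ n K λ)` —
  **`g ↦ ⨂_τ V_{λ_τ}(τ̃ g)`** [cite: BorelWallach2000, VII §2 (2.2), the module `(ρ, E)`], its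
  Leibniz differential `archCoeffLie`, `archCoeffRep_apply_tprod`,
  `finiteDimensional_coeffModule`, `isDifferentiableRep_archCoeff`, and
  `isGKModule_archCoeff` — **`E_λ(ℂ)` is a `(𝔤, K_∞)`-module** [cite: BorelWallach2000, 0 §2.3–2.5];
* `archCoeffRep_diagArch` — **on `GL_n(K) ⊆ G_∞` (`ParallelWeight.diagArch`) it is the Betti
  coefficient representation `ResGLnCohomology.coeffRep ℂ n K λ`** (`τ̃ ∘ ι_∞ = τ`), and
  `diagArchPos`, `archCoeffRep_diagArchPos` — the same on `GL_n(K)⁺`, the group of the receptacle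
  (`ResGLnCohomology.coeffRepPos`) [cite: Harder1987, §1.1 (the sheaves `M̃`)]
  [cite: GrobnerRaghuram2014, §7.1];
* `archCoeffRep_const`, `archCoeffLie_const` — for a constant family `λ = fun _ => wt` these are
  the parallel-weight `ParallelWeight.archCoeffRep / archCoeffLie` (same term on the same tensor
  product; the two carriers are definitionally equal).

## Mathlib / Literature search

Tree: `ParallelWeight.factorRep/factorLie/isDifferentiableRep_factor/factorRep_apply/diagArch/
map_embeddingExt_diagArch/finiteDimensional_coeffModule` (`ArchCoefficientModule`),
`RealMatrixGroup.PiTensor.piRep/piLie/isDifferentiableRep` (`GKModulePiTensor`),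
`IsDifferentiableRep.isGKModule`, `ResGLnCohomology.CoeffModule/coeffRep/coeffRepPos/
coeffRep_apply_tprod/CoeffModule.hom_ext` (`ResGLnCohomology`).
`lean search 'archCoeff'`: only the parallel-weight module.

## References

* A. Borel, N. Wallach, *Continuous cohomology, discrete subgroups, and representations of
  reductive groups*, 2nd ed. (2000), 0 §2.3–2.5 and VII §2 [BorelWallach2000].
* H. Grobner, A. Raghuram, Int. J. Number Theory 10 (2014) = arXiv:1102.1872, §7.1
  [GrobnerRaghuram2014].
* L. Clozel, *Motifs et formes automorphes* (1990), §3.5 (p. 122) [Clozel1990].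
* G. Harder, Invent. Math. 89 (1987), §1.1 [Harder1987].
-/

noncomputable section

namespace Literature.NumberTheory.Automorphic

open Module
open scoped TensorProduct

-- Mathlib idiom (as in `GKModules`): commutator bracket on `Module.End`
attribute [local instance 100] LieRing.ofAssociativeRing

namespace ResGLnCohomology

open RealMatrixGroup ParallelWeight _root_.NumberField _root_.NumberField.mixedEmbedding
-- `Classical`: the place subtypes indexing `mixedSpace K` are `Fintype` classically (as in
-- `AdelicGLnGlue` / `ArchCoefficientModule`); it also supplies `DecidableEq (K →+* ℂ)`.
open scoped MatrixGroups Classical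

variable (n : ℕ) (K : Type) [Field K] [NumberField K] (lam : (K →+* ℂ) → Fin n → ℤ)

/-! #### `E_λ(ℂ) = ⨂_τ V_{λ_τ}(ℂ) ∘ GL_n(τ̃)` -/

/-- **The archimedean coefficient module `E_λ(ℂ)` for a general weight family**: the
representation `g ↦ ⨂_{τ : K → ℂ} V_{λ_τ}(τ̃(g))` of `G_∞ = GL_n(K_∞)` on
`ResGLnCohomology.CoeffModule ℂ n K λ = ⨂_τ V_{λ_τ}(ℂ)`, the tensor product over the embeddings
of the one-embedding factors `ParallelWeight.factorRep K n (λ τ) τ`.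
[cite: BorelWallach2000, VII §2 (2.2)] [cite: GrobnerRaghuram2014, §7.1] -/
def archCoeffRep : Representation ℂ (archGroupGL n K).carrier (CoeffModule ℂ n K lam) :=
  show Representation ℂ (archGroupGL n K).carrier
      (⨂[ℂ] τ : (K →+* ℂ), GLnCohomology.CoeffModule ℂ n (lam τ)) from
    PiTensor.piRep (archGroupGL n K) fun τ => factorRep K n (lam τ) τ

/-- Its Leibniz differential `X ↦ ∑_τ 1 ⊗ ⋯ ⊗ dV_{λ_τ}(τ̃ X) ⊗ ⋯ ⊗ 1`.
[cite: BorelWallach2000, 0 §2.3] -/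
def archCoeffLie : (archGroupGL n K).lie →ₗ⁅ℝ⁆ Module.End ℂ (CoeffModule ℂ n K lam) :=
  show (archGroupGL n K).lie →ₗ⁅ℝ⁆
      Module.End ℂ (⨂[ℂ] τ : (K →+* ℂ), GLnCohomology.CoeffModule ℂ n (lam τ)) from
    PiTensor.piLie (archGroupGL n K) fun τ => factorLie K n (lam τ) τ

/-- Unfolding on pure tensors: `g · ⊗_τ v_τ = ⊗_τ V_{λ_τ}(τ̃ g) v_τ`. [folklore] -/
theorem archCoeffRep_apply_tprod (g : (archGroupGL n K).carrier)
    (v : ∀ τ : K →+* ℂ, GLnCohomology.CoeffModule ℂ n (lam τ)) :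
    archCoeffRep n K lam g (CoeffModule.tprod v) =
      CoeffModule.tprod fun τ => factorRep K n (lam τ) τ g (v τ) :=
  PiTensor.piRep_tprod (archGroupGL n K) _ g v

/-- `E_λ(ℂ)` is finite-dimensional (a tensor product of finitely many Weyl modules). [folklore] -/
theorem finiteDimensional_coeffModule : FiniteDimensional ℂ (CoeffModule ℂ n K lam) := by
  haveI : ∀ τ : K →+* ℂ, FiniteDimensional ℂ (GLnCohomology.CoeffModule ℂ n (lam τ)) :=
    fun τ => ParallelWeight.finiteDimensional_coeffModule n (lam τ)
  exact inferInstanceAs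
    (FiniteDimensional ℂ (⨂[ℂ] τ : (K →+* ℂ), GLnCohomology.CoeffModule ℂ n (lam τ)))

/-- **`E_λ(ℂ)` is a differentiable representation of `G_∞`** (Leibniz differential).
[cite: BorelWallach2000, 0 §2.3] -/
theorem isDifferentiableRep_archCoeff :
    IsDifferentiableRep (archGroupGL n K) (archCoeffRep n K lam) (archCoeffLie n K lam) := by
  haveI : ∀ τ : K →+* ℂ, FiniteDimensional ℂ (GLnCohomology.CoeffModule ℂ n (lam τ)) :=
    fun τ => ParallelWeight.finiteDimensional_coeffModule n (lam τ)
  exact PiTensor.isDifferentiableRep (archGroupGL n K) _ _ fun τ =>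
    isDifferentiableRep_factor K n (lam τ) τ

/-- **`E_λ(ℂ)`, restricted to `K_∞`, with its Leibniz differential, is a `(𝔤, K_∞)`-module** —
the coefficient `(𝔤, K_∞)`-module of the relative Lie algebra cohomology
`H^•(𝔤, K_∞; π_∞ ⊗ E_λ)` whose comparison with `H^•(S_{K_f}, Ẽ_λ)` is the Eichler–Shimura /
Borel–Wallach isomorphism. [cite: BorelWallach2000, 0 §2.4–2.5; VII §2] -/
theorem isGKModule_archCoeff :
    IsGKModule (archGroupGL n K) (restrictK (archGroupGL n K) (archCoeffRep n K lam))
      (archCoeffLie n K lam) := by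
  haveI : FiniteDimensional ℂ (CoeffModule ℂ n K lam) := finiteDimensional_coeffModule n K lam
  exact (isDifferentiableRep_archCoeff n K lam).isGKModule

/-! #### Restriction to `GL_n(K)` and `GL_n(K)⁺`: the Betti coefficients -/

/-- **On `GL_n(K) ⊆ G_∞` the archimedean coefficient module is the Betti coefficient
representation `ResGLnCohomology.coeffRep ℂ n K λ = ⨂_τ V_{λ_τ}(ℂ) ∘ GL_n(τ)`** (`τ̃ ∘ ι_∞ = τ`,
`ParallelWeight.map_embeddingExt_diagArch`). [cite: Harder1987, §1.1]
[cite: GrobnerRaghuram2014, §7.1] -/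
theorem archCoeffRep_diagArch (g : GL (Fin n) K) :
    archCoeffRep n K lam (diagArch K n g) = coeffRep ℂ n K lam g := by
  refine CoeffModule.hom_ext fun v => ?_
  rw [archCoeffRep_apply_tprod, coeffRep_apply_tprod]
  congr 1
  funext τ
  rw [factorRep_apply, map_embeddingExt_diagArch]

/-- `GL_n(K)⁺ → G_∞ = GL_n(K_∞)`: the restriction of `ParallelWeight.diagArch` to the group
`GL_n(K)⁺` of the receptacle `S_{K_f} = GL_n(K)⁺\(X⁺ × GL_n(𝔸_K^∞)/K_f)`. [folklore] -/
def diagArchPos : glTotPos n K →* (archGroupGL n K).carrier :=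
  (diagArch K n).comp (glTotPos n K).subtype

/-- Unfolding. [folklore] -/
@[simp]
theorem diagArchPos_apply (γ : glTotPos n K) : diagArchPos n K γ = diagArch K n (γ : GL (Fin n) K) :=
  rfl

/-- **On `GL_n(K)⁺` the archimedean coefficient module is `ResGLnCohomology.coeffRepPos ℂ n K λ`**,
the coefficient representation of `levelCohomology ℂ n K 𝔫 λ q`. [cite: GrobnerRaghuram2014, §7.1] -/
theorem archCoeffRep_diagArchPos (γ : glTotPos n K) :
    archCoeffRep n K lam (diagArchPos n K γ) = coeffRepPos ℂ n K lam γ := by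
  rw [diagArchPos_apply, archCoeffRep_diagArch, coeffRepPos_apply]

/-! #### Constant families: the parallel-weight module -/

/-- For a constant family `λ = fun _ => wt` the carriers `ResGLnCohomology.CoeffModule ℂ n K λ`
and `ParallelWeight.CoeffModule ℂ K n wt` are the same tensor product and `archCoeffRep` IS the
parallel-weight `ParallelWeight.archCoeffRep K n wt`. [folklore] -/
theorem archCoeffRep_const (wt : Fin n → ℤ) :
    archCoeffRep n K (fun _ => wt) =
      (show Representation ℂ (archGroupGL n K).carrier (CoeffModule ℂ n K fun _ => wt) from
        ParallelWeight.archCoeffRep K n wt) :=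
  rfl

/-- Likewise for the Leibniz differentials. [folklore] -/
theorem archCoeffLie_const (wt : Fin n → ℤ) :
    archCoeffLie n K (fun _ => wt) =
      (show (archGroupGL n K).lie →ₗ⁅ℝ⁆ Module.End ℂ (CoeffModule ℂ n K fun _ => wt) from
        ParallelWeight.archCoeffLie K n wt) :=
  rfl

end ResGLnCohomology

end Literature.NumberTheory.Automorphic

end
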